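import Mathlib
import Literature.MathematicalPhysics.QuantumFieldTheory.Balaban1983to89.B9Thm37GlueTorusCov
import Summits.QuantumFields.BalabanUV.T4Continuum.Support.SliceTorusTower

/-!
# T⁴ programme, node NE3 (η-rate of the minimisers) — the LEXICOGRAPHIC COMB of the periodic torus `(ℤ/T)^d` with the
# cube blocks of the NE3 tower (non-vacuity of the structural data of the covariant skeleton)

Thirteenth generation of the NE3 prover lineage P1 of the cell `pub-balaban`, file 3/3.  The covariant edition of NE3's
skeleton (`SliceCovariantSkeleton.ne3Shape_torusCov_of_printedStatements`, file 2/3) takes as DATA, per level, a bond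
structure `src, tgt : Bd → (ℤ/NL^k)^d`, bond weights `c ≠ 0`, an isometric transport `Rm`, gauge forms `Ng ⪰ 0`, and combs
`Kc j : Comb src tgt ((ℤ/NL^{k−j})^d)` (pv21's `B9Thm37GlueTorusCov.Comb`, the contours Γ_{y,x} of [B9] (3.19) as a rooted
forest) whose blocks ARE the level-`j` cubes: `hblk : (Kc j).blk = cube d k N L j`.  pv21 constructed such a comb on ITS
carrier `UT N` (`torusComb`, Fin-based); the NE3 tower lives on `TPt d T = Fin d → ZMod T` with the blocks `blockPt M e`
of `SliceTorusBlocks` (`T = M·e`).  THIS FILE constructs the comb there, so that the structural hypotheses of the covariant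
skeleton are INHABITED on every torus level (nothing is assumed into existence):
 * §1 the nearest-neighbour bond structure of `(ℤ/T)^d`: bonds `(x, μ)`, `bsrcT (x, μ) = x`, `btgtT (x, μ) = x + e_μ`;
 * §2 offsets `offsT e x μ = val(x_μ) mod e`, depth `tdepthT e x = Σ_μ offsT` (the ℓ¹ distance to the block corner), the
   comb axis (first coordinate with non-zero offset), the step `dnT x μ = x − e_μ` and its arithmetic in `ZMod T`;
 * §3 **`torusCombT hT : Comb (bsrcT d T) (btgtT d T) (TPt d M)`** for `T = M·e`: blocks `blockPt M e`, base points the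
   block corners `baseT e y = (e·val y_μ)_μ`, parent `x − e_μ` along the comb axis, parent bond `(x − e_μ, μ)`; and its
   tower instance **`cubeComb d n N L j`** with `cubeComb_blk : (cubeComb … j).blk = cube d n N L j` (by `rfl`);
 * §4 **`structuralData_inhabited`**: on every torus level the data `(Kc, c, Rm, Ng)` of the covariant skeleton EXIST with
   `hRm` (identity transport = the flat background), `hc` (`c = 1`), `hNg` (`Ng = 0`), `hblk` — so the covariant edition
   hides no contradiction in its structural hypotheses, and `SliceCovariantModel.posDef_kFull` /
   `sum_sliceKernel_cov` apply to an honest operator family on the NE3 carrier (the flat rung's operators at `Rm = 1`).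
HONEST: the comb of this file is the lexicographic path to the block CORNER (pv21's pattern); [B9] (3.19) composes the
contours Γ^{(j)} scale by scale (a path of paths) — a different rooted forest with the same blocks; every comb-generic
theorem of `SliceCovariantModel` / `SliceCovariantSkeleton` covers both, and only the SAMENESS OF FORM is claimed.

Honest framing: finite-T⁴ ultraviolet bookkeeping about MINIMISERS (rung (B)+1 of the cell's ladder); no conditional of
the cell (`BetaPertH`, (B), (B^μ)) is used or hidden; nothing bears on infinite volume, a mass gap, or the Clay problem;
**NE3 is NOT proved**.  ABSOLUTE RULE of the cell kept: nothing printed is asserted; every declaration is a MODEL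
definition or a kernel-checked [folklore] theorem (integer arithmetic in `ZMod`).  No `sorry`, no axioms beyond Mathlib's.
PLACEMENT (human rule 2026-08-19): cell work under `Summits/QuantumFields/BalabanUV/`; imports pv21's
`B9Thm37GlueTorusCov` (the `Comb` structure) and `Support.SliceTorusTower` (p195432); moves nothing.  Records: `t4/T4-EST-U1b-OSC.md` v1.25 (RESULT 32), `t4/T4-EST-NE3-P1.md`
v2.24, GAPS G-ne3p1-39 of the cell `pub-balaban`.
-/

noncomputable section

open Finset

namespace Summit.QuantumFields.BalabanUV.T4Continuum.SliceTorusComb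

open Literature.MathematicalPhysics.QuantumFieldTheory.Balaban1983to89
open Literature.MathematicalPhysics.QuantumFieldTheory.Balaban1983to89.TreeLengthTorus (TPt)
open Literature.MathematicalPhysics.QuantumFieldTheory.Balaban1983to89.B9Thm37GlueTorusCov (Comb)
open Summit.QuantumFields.BalabanUV.T4Continuum.SliceTorusBlocks
open Summit.QuantumFields.BalabanUV.T4Continuum.SliceTorusTower

/-! ## §1  The nearest-neighbour bond structure of `(ℤ/T)^d` -/
section Bonds

variable (d T : ℕ)

/-- The BONDS of the periodic torus `(ℤ/T)^d`: a site and a direction, `(x, μ) : x → x + e_μ`. [model] [folklore] -/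
abbrev TBond : Type := TPt d T × Fin d

/-- The source of the bond `(x, μ)` is `x`. [model] [folklore] -/
def bsrcT (b : TBond d T) : TPt d T := b.1

/-- The target of the bond `(x, μ)` is `x + e_μ`. [model] [folklore] -/
def btgtT (b : TBond d T) : TPt d T := Function.update b.1 b.2 (b.1 b.2 + 1)

end Bonds

/-! ## §2  Offsets, depth, comb axis and the step `x − e_μ` -/
section Offsets

variable {d T : ℕ}

/-- The offset of the `μ`-th coordinate inside its block of side `e`: `val(x_μ) mod e`. [folklore] -/
def offsT (e : ℕ) (x : TPt d T) (μ : Fin d) : ℕ := (x μ).val % e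

/-- The comb depth of a torus point: the sum of its offsets (the ℓ¹ distance to the block corner). [folklore] -/
def tdepthT (e : ℕ) (x : TPt d T) : ℕ := ∑ μ, offsT e x μ

/-- Positive depth means some offset is non-zero. [folklore] -/
theorem exists_offsT_ne_zero {e : ℕ} {x : TPt d T} (hx : tdepthT e x ≠ 0) : ∃ μ, offsT e x μ ≠ 0 := by
  by_contra h
  simp only [not_exists, not_not] at h
  exact hx (Finset.sum_eq_zero fun μ _ => h μ)

/-- Zero depth means every offset vanishes. [folklore] -/
theorem offsT_eq_zero_of_tdepthT {e : ℕ} {x : TPt d T} (hx : tdepthT e x = 0) (μ : Fin d) : offsT e x μ = 0 := by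
  by_contra h
  have hpos : 0 < tdepthT e x :=
    lt_of_lt_of_le (Nat.pos_of_ne_zero h)
      (Finset.single_le_sum (f := offsT e x) (fun ν _ => Nat.zero_le _) (mem_univ μ))
  omega

/-- The step `x − e_μ`. [folklore] -/
def dnT (x : TPt d T) (μ : Fin d) : TPt d T := Function.update x μ (x μ - 1)

/-- Off the axis the step changes nothing. [folklore] -/
theorem dnT_of_ne (x : TPt d T) {μ i : Fin d} (h : i ≠ μ) : dnT x μ i = x i := by
  unfold dnT
  rw [Function.update_of_ne h]

/-- On the axis the step subtracts one. [folklore] -/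
theorem dnT_self (x : TPt d T) (μ : Fin d) : dnT x μ μ = x μ - 1 := by
  unfold dnT
  rw [Function.update_self]

/-- **The bond `(x − e_μ, μ)` ends at `x`.** [folklore] -/
theorem btgtT_dnT (x : TPt d T) (μ : Fin d) : btgtT d T (dnT x μ, μ) = x := by
  unfold btgtT
  simp only
  rw [dnT_self, sub_add_cancel]
  unfold dnT
  rw [Function.update_idem, Function.update_eq_self]

/-- The value of `x_μ − 1` is `val(x_μ) − 1` when `val(x_μ) ≠ 0`. [folklore] -/
theorem val_dnT_self [NeZero T] (x : TPt d T) (μ : Fin d) (h : (x μ).val ≠ 0) :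
    (dnT x μ μ).val = (x μ).val - 1 := by
  rw [dnT_self]
  have hT : 1 < T := by
    have := ZMod.val_lt (x μ)
    omega
  haveI : Fact (1 < T) := ⟨hT⟩
  have h1 : (1 : ZMod T).val = 1 := ZMod.val_one T
  rw [ZMod.val_sub (by rw [h1]; omega), h1]

variable [NeZero d]

/-- The comb axis at `x`: the first coordinate with non-zero offset (axis `0` if there is none). [folklore] -/
def axisT (e : ℕ) (x : TPt d T) : Fin d :=
  if h : ∃ μ, offsT e x μ ≠ 0 then Fin.find (fun μ => offsT e x μ ≠ 0) h else 0

/-- At positive depth the comb axis has non-zero offset. [folklore] -/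
theorem offsT_axis_ne_zero {e : ℕ} {x : TPt d T} (hx : tdepthT e x ≠ 0) : offsT e x (axisT e x) ≠ 0 := by
  have h := exists_offsT_ne_zero hx
  unfold axisT
  rw [dif_pos h]
  exact Fin.find_spec h

/-- Along the comb axis: the offset drops by one, the block index `⌊val/e⌋` is unchanged. [folklore] -/
theorem offsT_dnT_axis [NeZero T] {e : ℕ} (he : 1 ≤ e) {x : TPt d T} (hx : tdepthT e x ≠ 0) :
    offsT e (dnT x (axisT e x)) (axisT e x) + 1 = offsT e x (axisT e x) ∧
      (dnT x (axisT e x) (axisT e x)).val / e = (x (axisT e x)).val / e := by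
  have hoff := offsT_axis_ne_zero hx
  have hv0 : (x (axisT e x)).val ≠ 0 := by
    intro h0
    apply hoff
    show (x (axisT e x)).val % e = 0
    rw [h0, Nat.zero_mod]
  have hdn := val_dnT_self x (axisT e x) hv0
  have hoff' : (x (axisT e x)).val % e ≠ 0 := hoff
  unfold offsT
  generalize (x (axisT e x)).val = v at hdn hoff' ⊢
  have h1 := Nat.div_add_mod v e
  have hlt : v % e < e := Nat.mod_lt v he
  have hr : 1 ≤ v % e := Nat.one_le_iff_ne_zero.mpr hoff'
  have he' : v - 1 = e * (v / e) + (v % e - 1) := by omega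
  refine ⟨?_, ?_⟩
  · rw [hdn, he', Nat.mul_add_mod, Nat.mod_eq_of_lt (show v % e - 1 < e by omega)]
    omega
  · rw [hdn, he', Nat.mul_add_div he, Nat.div_eq_of_lt (show v % e - 1 < e by omega), add_zero]

/-- The depth of `x − e_μ` along the comb axis is one less. [folklore] -/
theorem tdepthT_dnT_axis [NeZero T] {e : ℕ} (he : 1 ≤ e) {x : TPt d T} (hx : tdepthT e x ≠ 0) :
    tdepthT e (dnT x (axisT e x)) + 1 = tdepthT e x := by
  have hoff := (offsT_dnT_axis he hx).1
  have hA : offsT e x (axisT e x) + (univ.erase (axisT e x)).sum (offsT e x) = tdepthT e x :=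
    Finset.add_sum_erase univ (offsT e x) (mem_univ _)
  have hB : offsT e (dnT x (axisT e x)) (axisT e x)
      + (univ.erase (axisT e x)).sum (offsT e (dnT x (axisT e x))) = tdepthT e (dnT x (axisT e x)) :=
    Finset.add_sum_erase univ (offsT e (dnT x (axisT e x))) (mem_univ _)
  have hS : (univ.erase (axisT e x)).sum (offsT e (dnT x (axisT e x))) = (univ.erase (axisT e x)).sum (offsT e x) :=
    Finset.sum_congr rfl fun μ hμ => by
      show (dnT x (axisT e x) μ).val % e = (x μ).val % e
      rw [dnT_of_ne x (Finset.ne_of_mem_erase hμ)]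
  rw [hS] at hB
  omega

end Offsets

/-! ## §3  CONSTRUCTION: the lexicographic comb of `(ℤ/T)^d` with the blocks `blockPt M e`, `T = M·e` -/
section Construction

variable {d T M e : ℕ}

/-- The BASE POINT of the block `y ∈ (ℤ/M)^d`: its corner `(e·val y_μ)_μ ∈ (ℤ/T)^d`. [model] [folklore] -/
def baseT (e : ℕ) (y : TPt d M) : TPt d T := fun μ => (((y μ).val * e : ℕ) : ZMod T)

variable [NeZero d] [NeZero T]

/-- **CONSTRUCTION: the lexicographic comb of the torus `(ℤ/T)^d` with the blocks of `SliceTorusBlocks.blockPt M e`**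
(`T = M·e`): base points the block corners, parent of `x` = `x − e_μ` along the first axis `μ` with non-zero offset,
parent bond the nearest-neighbour bond `(x − e_μ, μ)`. [folklore] -/
def torusCombT (hT : T = M * e) : Comb (bsrcT d T) (btgtT d T) (TPt d M) where
  blk := blockPt M e
  base := baseT e
  depth := tdepthT e
  parent x := dnT x (axisT e x)
  pbond x := (dnT x (axisT e x), axisT e x)
  eq_base x hx := by
    funext μ
    show x μ = (((blockOf M e (x μ)).val * e : ℕ) : ZMod T)
    rw [val_blockOf hT]
    have h1 := Nat.div_add_mod (x μ).val e
    have h2 : (x μ).val % e = 0 := offsT_eq_zero_of_tdepthT hx μ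
    have h3 : (x μ).val / e * e = (x μ).val := by rw [Nat.mul_comm]; omega
    rw [h3, ZMod.natCast_zmod_val]
  src_pbond x hx := rfl
  tgt_pbond x hx := btgtT_dnT x (axisT e x)
  depth_parent x hx := tdepthT_dnT_axis (pos_of_mul_eq hT) hx
  blk_parent x hx := by
    funext μ
    show blockOf M e (dnT x (axisT e x) μ) = blockOf M e (x μ)
    by_cases hμ : μ = axisT e x
    · rw [hμ]
      unfold SliceTorusBlocks.blockOf
      rw [(offsT_dnT_axis (pos_of_mul_eq hT) hx).2]
    · rw [dnT_of_ne x hμ]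

/-- The blocks of the torus comb are the block points, by `rfl`. [folklore] -/
theorem torusCombT_blk (hT : T = M * e) (x : TPt d T) : (torusCombT (d := d) hT).blk x = blockPt M e x := rfl

/-- The base points of the torus comb are the block corners, by `rfl`. [folklore] -/
theorem torusCombT_base (hT : T = M * e) (y : TPt d M) : (torusCombT (d := d) hT).base y = baseT e y := rfl

end Construction

/-! ## §3b  The tower instance: one comb per level of the NE3 torus `(ℤ/NLⁿ)^d`, blocks = the level-`j` cubes -/
section TowerInstance

variable (d n N L : ℕ) [NeZero d] [NeZero N] [NeZero L]

/-- **The level-`j` comb of the NE3 tower**: the lexicographic comb of `(ℤ/NLⁿ)^d` with blocks of side `L^{min(j,n)}`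
indexed by `(ℤ/NL^{n−j})^d` — the data `Kc j` of `SliceCovariantSkeleton.ne3Shape_torusCov_of_printedStatements`.
[model] [folklore] -/
def cubeComb (j : ℕ) : Comb (bsrcT d (N * L ^ n)) (btgtT d (N * L ^ n)) (TPt d (levM n N L j)) :=
  torusCombT (fine_eq_levM_mul_side n N L j)

/-- **Binder `hblk` discharged**: the blocks of the level-`j` comb ARE the level-`j` cubes, by `rfl`. [folklore] -/
theorem cubeComb_blk (j : ℕ) (x : TPt d (N * L ^ n)) : (cubeComb d n N L j).blk x = cube d n N L j x := rfl

end TowerInstance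

/-! ## §4  Non-vacuity of the structural data of the covariant skeleton -/
section NonVacuity

variable (d n N L : ℕ) [NeZero d] [NeZero N] [NeZero L] (Cp : Type) [Fintype Cp] [DecidableEq Cp]

omit [NeZero d] [NeZero N] [NeZero L] in
/-- The identity transport is isometric (the binder `hRm` at the flat background). [folklore] -/
theorem flat_isometric (b : TBond d (N * L ^ n)) (i j : Cp) :
    ∑ k, (fun (_ : TBond d (N * L ^ n)) (k i : Cp) => if k = i then (1 : ℝ) else 0) b k i
      * (fun (_ : TBond d (N * L ^ n)) (k i : Cp) => if k = i then (1 : ℝ) else 0) b k j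
      = if i = j then (1 : ℝ) else 0 := by
  simp only
  rw [Finset.sum_eq_single i (fun k _ hk => by rw [if_neg hk, zero_mul]) (fun h => absurd (Finset.mem_univ i) h),
    if_pos rfl, one_mul]

/-- **The structural hypotheses of `ne3Shape_torusCov_of_printedStatements` are INHABITED on every torus level**: combs
with `blk = cube` (`cubeComb`), bond weights `c = 1 ≠ 0`, the isometric identity transport (flat background), gauge
forms `Ng = 0 ⪰ 0`.  Hence `SliceCovariantModel.posDef_kFull` / `sum_sliceKernel_cov` speak about an honest, non-empty
operator family on the NE3 carrier. [folklore] -/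
theorem structuralData_inhabited :
    ∃ (Kc : ∀ j : ℕ, Comb (bsrcT d (N * L ^ n)) (btgtT d (N * L ^ n)) (TPt d (levM n N L j)))
      (c : TBond d (N * L ^ n) → ℝ) (Rm : TBond d (N * L ^ n) → Cp → Cp → ℝ)
      (Ng : ℕ → Matrix (TPt d (N * L ^ n) × Cp) (TPt d (N * L ^ n) × Cp) ℝ),
      (∀ b i j, ∑ k, Rm b k i * Rm b k j = if i = j then (1 : ℝ) else 0) ∧ (∀ b, c b ≠ 0) ∧
        (∀ j, (Ng j).PosSemidef) ∧ (∀ j x, (Kc j).blk x = cube d n N L j x) :=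
  ⟨cubeComb d n N L, fun _ => 1, fun _ k i => if k = i then 1 else 0, fun _ => 0,
    flat_isometric d n N L Cp, fun _ => one_ne_zero, fun _ => Matrix.PosSemidef.zero, cubeComb_blk d n N L⟩

end NonVacuity

/-! ## §5  Examples (the comb computes) -/
section Examples

/-- On `(ℤ/6)^1` with blocks of side `3` (`6 = 2·3`): the point `5` has offset `2`, hence depth `2`. -/
example : tdepthT 3 (fun _ : Fin 1 => (5 : ZMod 6)) = 2 := by decide

/-- Its block (`torusCombT_blk`: the block point) is `1 = ⌊5/3⌋ ∈ ℤ/2`, and the base point of that block is the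
corner `3 ∈ ℤ/6`. -/
example : blockPt 2 3 (fun _ : Fin 1 => (5 : ZMod 6)) = fun _ => (1 : ZMod 2) := by decide

example : baseT (d := 1) (T := 6) 3 (fun _ : Fin 1 => (1 : ZMod 2)) = fun _ => (3 : ZMod 6) := by decide

end Examples

end Summit.QuantumFields.BalabanUV.T4Continuum.SliceTorusComb
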